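import Mathlib
import HarnessLib
import Literature.Geometry.DiscreteGeometry.LayerShellPatterns

/-!
# Local layer propagation, FCC case: the lattice of the FCC layer shell is a Barlow stacking

Route `BrittleRungDescent`, support item `SoftLayerPropagation` (stmt-AtomisticToContinuum-9210),
helper file (vocabulary of `BarlowStacking.lean` / `LayerShellPatterns.lean`).
`haggLabel_constSeq`, `barlowPos_const_add_layerShell`, `closure_layerShell_subset`: the lattice
generated by the FCC layer shell `layerShell σ (−σ)` lies in the Barlow stacking of the constant
Hägg sequence `σ` (the FCC stacking or its mirror image).  All elementary ([folklore]).
-/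

noncomputable section

namespace Summit.AtomisticToContinuum.Crystallization.Theorems

open Literature.Geometry.DiscreteGeometry Literature.MathematicalPhysics.StatisticalMechanics
open RealInnerProductSpace

/-! ### The lattice of the FCC layer shell is a Barlow stacking -/

/-- Labels of a constant sequence: `L m = σ m`. [folklore] -/
theorem haggLabel_constSeq (σ : ℤ) (m : ℤ) : haggLabel (fun _ => σ) m = σ * m := by
  induction m using Int.induction_on with
  | zero => simp
  | succ k ih => rw [haggLabel_succ, ih]; ring
  | pred k ih =>
    have h := haggLabel_succ (fun _ => σ) (-(k : ℤ) - 1)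
    rw [show -(k : ℤ) - 1 + 1 = -(k : ℤ) by ring, ih] at h
    linarith

/-- **One shell step stays in the stacking**: a point of the constant-`σ` stacking plus a vector
of `layerShell σ (−σ)` is a point of the stacking. [folklore] -/
theorem barlowPos_const_add_layerShell {σ : ℤ} (k i j : ℤ)
    {a : EuclideanSpace ℝ (Fin 3)} (ha : a ∈ layerShell (σ : ℝ) (-(σ : ℝ))) :
    barlowPos 2 layerSpacing (fun _ => σ) k i j + a ∈ barlowStacking 2 layerSpacing (fun _ => σ) := by
  have key : ∀ k' i' j' : ℤ, barlowPos 2 layerSpacing (fun _ => σ) k' i' j' =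
      (i' : ℝ) • triangularVec₁ 2 + (j' : ℝ) • triangularVec₂ 2 + ((σ * k' : ℤ) : ℝ) • barlowOffset 2 +
        (k' : ℝ) • layerNormal layerSpacing := by
    intro k' i' j'
    simp only [barlowPos, haggLabel_constSeq]
  rcases mem_layerShell_iff.1 ha with h | h | h
  · -- hexagon: in-layer step
    simp only [hexagonSet, Set.mem_insert_iff, Set.mem_singleton_iff] at h
    rcases h with rfl | rfl | rfl | rfl | rfl | rfl
    · exact ⟨k, i + 1, j, by rw [key, key]; push_cast; module⟩
    · exact ⟨k, i - 1, j, by rw [key, key]; push_cast; module⟩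
    · exact ⟨k, i, j + 1, by rw [key, key]; push_cast; module⟩
    · exact ⟨k, i, j - 1, by rw [key, key]; push_cast; module⟩
    · exact ⟨k, i + 1, j - 1, by rw [key, key]; push_cast; module⟩
    · exact ⟨k, i - 1, j + 1, by rw [key, key]; push_cast; module⟩
  · -- upper triple: `a = t + 𝗁e₃`, `t ∈ holeTriple σ`
    rw [mem_holeTriple_iff] at h
    obtain ⟨t₁, ht₁, ht⟩ := h
    have hae : a = (σ : ℝ) • t₁ + layerNormal layerSpacing := by rw [← ht]; abel
    rw [mem_holeTriple_one_iff] at ht₁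
    rcases ht₁ with rfl | rfl | rfl
    · refine ⟨k + 1, i, j, ?_⟩
      rw [key, key, hae]; push_cast; module
    · refine ⟨k + 1, i - σ, j, ?_⟩
      rw [key, key, hae]; push_cast; module
    · refine ⟨k + 1, i, j - σ, ?_⟩
      rw [key, key, hae]; push_cast; module
  · -- lower triple: `a = t − 𝗁e₃`, `t ∈ holeTriple (−σ)`
    rw [mem_holeTriple_iff] at h
    obtain ⟨t₁, ht₁, ht⟩ := h
    have hae : a = (-(σ : ℝ)) • t₁ - layerNormal layerSpacing := by rw [← ht]; abel
    rw [mem_holeTriple_one_iff] at ht₁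
    rcases ht₁ with rfl | rfl | rfl
    · refine ⟨k - 1, i, j, ?_⟩
      rw [key, key, hae]; push_cast; module
    · refine ⟨k - 1, i + σ, j, ?_⟩
      rw [key, key, hae]; push_cast; module
    · refine ⟨k - 1, i, j + σ, ?_⟩
      rw [key, key, hae]; push_cast; module

/-- **The lattice generated by the FCC layer shell lies in the constant-`σ` Barlow stacking.**
[folklore] -/
theorem closure_layerShell_subset {σ : ℤ} :
    ((AddSubgroup.closure (layerShell (σ : ℝ) (-(σ : ℝ)))) : Set (EuclideanSpace ℝ (Fin 3))) ⊆
      barlowStacking 2 layerSpacing (fun _ => σ) := by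
  -- the stacking is a subgroup
  have hneg : ∀ x ∈ barlowStacking 2 layerSpacing (fun _ => σ), -x ∈ barlowStacking 2 layerSpacing (fun _ => σ) := by
    rintro _ ⟨k, i, j, rfl⟩
    refine ⟨-k, -i, -j, ?_⟩
    simp only [barlowPos, haggLabel_constSeq]; push_cast; module
  have hadd : ∀ x ∈ barlowStacking 2 layerSpacing (fun _ => σ), ∀ y ∈ barlowStacking 2 layerSpacing (fun _ => σ),
      x + y ∈ barlowStacking 2 layerSpacing (fun _ => σ) := by
    rintro _ ⟨k, i, j, rfl⟩ _ ⟨k', i', j', rfl⟩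
    refine ⟨k + k', i + i', j + j', ?_⟩
    simp only [barlowPos, haggLabel_constSeq]; push_cast; module
  have hzero : (0 : EuclideanSpace ℝ (Fin 3)) ∈ barlowStacking 2 layerSpacing (fun _ => σ) :=
    ⟨0, 0, 0, by simp [barlowPos]⟩
  let K : AddSubgroup (EuclideanSpace ℝ (Fin 3)) :=
    { carrier := barlowStacking 2 layerSpacing (fun _ => σ)
      add_mem' := fun hx hy => hadd _ hx _ hy
      zero_mem' := hzero
      neg_mem' := fun hx => hneg _ hx }
  have hsub : layerShell (σ : ℝ) (-(σ : ℝ)) ⊆ (K : Set (EuclideanSpace ℝ (Fin 3))) := by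
    intro a ha
    have := barlowPos_const_add_layerShell (σ := σ) 0 0 0 ha
    have h0 : barlowPos 2 layerSpacing (fun _ => σ) 0 0 0 = 0 := by simp [barlowPos]
    rw [h0, zero_add] at this
    exact this
  have hle : AddSubgroup.closure (layerShell (σ : ℝ) (-(σ : ℝ))) ≤ K := (AddSubgroup.closure_le K).2 hsub
  intro x hx
  exact hle hx


end Summit.AtomisticToContinuum.Crystallization.Theorems

end
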